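import Summits.BirchSwinnertonDyer.BirchSwinnertonDyer.Theorems.BiquadraticEisensteinDescentEisensteinHeartFlatCMInertBadKPrimeRangeClassification
import Summits.BirchSwinnertonDyer.BirchSwinnertonDyer.Theorems.BiquadraticEisensteinDescentEisensteinHeartFlatCMInertBadKPrimeTiedFrameData
import Summits.BirchSwinnertonDyer.BirchSwinnertonDyer.Theorems.BiquadraticEisensteinDescentEisensteinHeartFlatCMInertBadKPrimeOfV4KOfKatzOnly
import HarnessLib

set_option linter.dupNamespace false -- `Summit.BirchSwinnertonDyer.BirchSwinnertonDyer.Theorems.…` (summit = sub, D-0017)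
set_option autoImplicit false

/-!
# Crux `EisensteinHeartFlatCMInertBadKPrime` (stmt-BirchSwinnertonDyer-21341), line `hsieh_lambda`, road (B′):
# THE KATZ LINE FRAME FROM THE ♭-FRAME — on Hsieh's range the crux's own `Q` takes the Katz-normalised values for ONE choice of the
# constants `(C_K, Ω, Ω′_p)`; hence the crux follows from the range form `V4R` of the input ALONE (no Katz measure, no Theorem A)

Route `BiquadraticEisensteinDescent` (cell `pub/bsd-wall`, lead-prover seat `bsd-wall-cm-bed-p1` g7). THEOREMS ONLY; supports, does not
close, stmt-BirchSwinnertonDyer-21341.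

## What is proved

* §1 `interpolationValue_eq_of_range` — the EXPLICIT Katz display on the range (two places `w₁ ≠ w₂`, Katz type `(1; n, n−1)`, branch
  ramified on `S ∪ {w ∣ p} ∪ Σ_p ∪ T`, `L(λ·χ∘N, 0) = RS(f ⊗ χ, 1)`, `a_p(f) = 0`, `p ∣ N`) with the constants `C_K = (Im σ₂(ϑ))⁻¹`,
  `Ω₁ = Ω₂ = s`: `Katz display(χ, n) = c₁(s)ⁿ · δ(χ) · bdpInterpolationValue(χ, n)`, `c₁(s) = π⁴Ω_K⁴/(Im σ₁(ϑ) Im σ₂(ϑ) s⁴)`,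
  `δ(χ) = ∏_{w ∈ Σ_p ∪ T} (χ∘N)(ϖ_w)^{−a(λ_w)}` (the w3 seat's `display_relation` made explicit; pure bookkeeping).
* §2 `exists_constants_rangeFrame` — for `K` imaginary quadratic, `p` odd, `κ` anticyclotomic, `p ∤ h_K` and a ♭-frame
  `R1.IsBDPLFunctionInt p ι 𝔭 κ γ f Ω_K Ω_p Q`: there are `C_K ≠ 0`, `Ω_w ≠ 0`, `Ω′_{p,w} ≠ 0` such that `Q` ITSELF has the Katz values
  on Hsieh's range: `Q(r(γ) − 1) = ι⁻¹(Katz display(χ, n)) · ∏_w Ω′_{p,w}^{1+2κ_n(w)}`. Proof: if the range is empty this is vacuous;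
  else let `n₀` be the least range type, `φ₁` a range character of type `n₀` (`Nat.find`); choose `s` with `s^{4n₀} =
  (π⁴Ω_K⁴/(Im σ₁ Im σ₂))^{n₀} · δ(φ₁)` (ℂ is algebraically closed) and `Ω′_p ≡ Ω_p`; by `…RangeClassification.exists_defect_eq_pow`
  every range `χ` of type `n` has `n = q n₀`, `δ(χ) = δ(φ₁)^q`, so `c₁(s)ⁿδ(χ) = (c₁(s)^{n₀}δ(φ₁))^q = 1` and the Katz value IS
  Castella's value, which `Q` takes by hypothesis.
* §3 `eisensteinHeartFlatCMInertBadKPrime_of_V4R` — **the crux from the RANGE FORM `V4R` of the input ALONE**: `V4R` is the registered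
  `stub_V4K` with its binder `KatzCM.IsBaseChangeLine ι′ Σ_p S T κ γ λ ϑ C_K Ω Ω′_p G` replaced by the values of `G` on Hsieh's range
  (the only values the line ever used). Given the crux data, `…TiedFrameData.exists_tiedFrameData` (unconditional) and §2 make the
  crux's `Q` an admissible `G`, and `V4R` at `G := Q` is the heart for the upper module, whence the crux by the CM-datum adapter.
  NO Katz–Hida–Tilouine measure, NO Hsieh Theorem A, NO Deuring hypothesis: 21341 = V4R + kernel theorems.

HONEST STATUS: `V4R` implies `V4K` outright and is equivalent to it granted the Katz measure (rigidity); both are the same research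
statement (NOT in print on the `p`-ramified niveau-2 branch). Nothing about any case of BSD is asserted; 21341 stays OPEN.

References: [Hsieh2014mu] Prop. 4.9 (§4.8), §4.7; [Castella2018] Thm. 3.1; [Washington1997] §13.1; [Brink2007] Cor. 1.
-/

noncomputable section

open scoped Classical NumberField
open NumberField IsDedekindDomain Field PowerSeries Finset
open WeierstrassCurve
open Literature.NumberTheory.EllipticCurves Literature.NumberTheory.GaloisRepresentations
open Literature.NumberTheory.EllipticCurves.ModularForms Literature.NumberTheory.EllipticCurves.Rank1Residual
  Literature.NumberTheory.EllipticCurves.Hsieh2014 Literature.NumberTheory.EllipticCurves.GreenbergSelmer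
  Literature.NumberTheory.EllipticCurves.Module Literature.NumberTheory.EllipticCurves.IwasawaDual
  Summit.BirchSwinnertonDyer.Rank1Residual Summit.BirchSwinnertonDyer.Rank1Residual.X11b
  Summit.BirchSwinnertonDyer.Rank1Residual.X11b.AcSelmer
  Summit.BirchSwinnertonDyer.BirchSwinnertonDyer.Theorems.BiquadraticEisensteinDescentDefs
  Summit.BirchSwinnertonDyer.BirchSwinnertonDyer.Theorems.BiquadraticEisensteinDescentEisensteinHeartFlatCMInertBadKPrimeSelmerTower
  Summit.BirchSwinnertonDyer.BirchSwinnertonDyer.Theorems.BiquadraticEisensteinDescentEisensteinHeartFlatCMInertBadKPrimeShapiroDatum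
  Summit.BirchSwinnertonDyer.BirchSwinnertonDyer.Theorems.BiquadraticEisensteinDescentEisensteinHeartFlatCMInertBadKPrimeCMDatumAdapter

namespace Summit.BirchSwinnertonDyer.BirchSwinnertonDyer.Theorems.BiquadraticEisensteinDescentEisensteinHeartFlatCMInertBadKPrimeKatzLineFromFlat

open Summit.BirchSwinnertonDyer.BirchSwinnertonDyer.Theorems.BiquadraticEisensteinDescentEisensteinHeartFlatCMInertBadKPrimeKatzHsiehDisplay
  (removedEulerFactorsAtZero_eq_one not_isUnramifiedAt_mul prod_eulerFactor_eq defect_ne_zero prod_univ_two archFactor_two)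
open Summit.BirchSwinnertonDyer.BirchSwinnertonDyer.Theorems.BiquadraticEisensteinDescentEisensteinHeartFlatCMInertBadKPrimeRangeClassification
  (exists_defect_eq_pow)

variable {p : ℕ} [Fact p.Prime] {K L : Type} [Field K] [NumberField K] [Field L] [NumberField L]
  [Algebra K L] [IsGalois K L]

/-! ### §1 The explicit Katz display on the range -/

/-- **The explicit Katz display on Hsieh's range** with the constants `C_K = (c_L·Im σ₂(ϑ))⁻¹`, `Ω₁ = Ω₂ = s`: at a range character `χ`
of type `(n, −n)`, `n ≥ 1`,
`interpolationValue ι Σ_p S T λ (χ∘N) 1 κ_n ϑ C_K Ω (L(λ·χ∘N, 0)) = c₁(s)ⁿ · δ(χ) · bdpInterpolationValue p f 𝔭 χ n Ω_K`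
with `c₁(s) = c_L′π⁴Ω_K⁴/(Im σ₁(ϑ)·Im σ₂(ϑ)·s⁴)` and `δ(χ) = ∏_{w ∈ Σ_p ∪ T} (χ∘N)(ϖ_w)^{−a(λ_w)}` — granted two places `w₁ ≠ w₂`, (L)
`L(λ·χ∘N, 0) = c_L c_L′ⁿ RS(f ⊗ χ, 1)`, (P) `p ∣ N`, `a_p(f) = 0`, (R). [cite: Hsieh2014mu, Prop. 4.9 (§4.8), §4.7] [cite: Castella2018, Thm. 3.1 (arXiv:1704.06608 p. 9)] -/
theorem interpolationValue_eq_of_range {ι : PadicAlgCl p ≃+* ℂ} {Sp S T : Finset (HeightOneSpectrum (𝓞 L))}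
    {lam : HeckeCharacter L} {ϑ : L} {N : ℕ} {f : CuspForm (CongruenceSubgroup.Gamma0 N) 2} {𝔭 : HeightOneSpectrum (𝓞 K)}
    {w₁ w₂ : InfinitePlace L} (hw : w₁ ≠ w₂) (huniv : ∀ w : InfinitePlace L, w = w₁ ∨ w = w₂)
    {cL cL' : ℂ} (hcL : cL ≠ 0) (hcL' : cL' ≠ 0)
    (hLval : ∀ (χ : HeckeCharacter K) (n : ℕ), 0 < n → (∀ v : HeightOneSpectrum (𝓞 K), χ.IsUnramifiedAt v) →
      χ.HasInfinityType (fun _ ↦ (n : ℤ)) (fun _ ↦ -(n : ℤ)) →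
      ∀ hL : LFunction.HasEntireContinuation (heckeLFunction (lam * χ.compRelNorm L)),
        hL.continuation 0 = cL * cL' ^ n * rankinSelbergValueHecke f χ 1)
    (hpN : p ∣ N) (hap : cuspCoeff f p = 0)
    (hramS : ∀ w ∈ S ∪ KatzCM.primesOver L p, ¬ lam.IsUnramifiedAt w)
    (hramT : ∀ w ∈ Sp ∪ T, ¬ lam.IsUnramifiedAt w)
    (hIm : ∀ w, (KatzCM.embeddingAt ι Sp w ϑ).im ≠ 0) {s : ℂ} (hs : s ≠ 0) {ΩK : ℂ} (hΩK : ΩK ≠ 0)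
    {χ : HeckeCharacter K} {n : ℕ} (hn : 0 < n) (hu : ∀ v : HeightOneSpectrum (𝓞 K), χ.IsUnramifiedAt v)
    (hi : χ.HasInfinityType (fun _ ↦ (n : ℤ)) (fun _ ↦ -(n : ℤ)))
    (hL : LFunction.HasEntireContinuation (heckeLFunction (lam * χ.compRelNorm L))) :
    KatzCM.interpolationValue ι Sp S T lam (χ.compRelNorm L) 1 (fun w ↦ if w = w₁ then n else n - 1) ϑ
        ((cL * (((KatzCM.embeddingAt ι Sp w₂ ϑ).im : ℝ) : ℂ))⁻¹) (fun _ ↦ s) (hL.continuation 0) =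
      (cL' * (Real.pi : ℂ) ^ 4 * ΩK ^ 4 /
          ((((KatzCM.embeddingAt ι Sp w₁ ϑ).im : ℝ) : ℂ) * (((KatzCM.embeddingAt ι Sp w₂ ϑ).im : ℝ) : ℂ) * s ^ 4)) ^ n *
        (∏ w ∈ Sp ∪ T, (χ.compRelNorm L).valueAtUniformizer w ^ (-(lam.conductorExponentAt w : ℤ))) *
        bdpInterpolationValue p f 𝔭 χ n ΩK := by
  obtain ⟨m, rfl⟩ : ∃ m, n = m + 1 := ⟨n - 1, (Nat.sub_add_cancel hn).symm⟩
  have hI₁0 : (((KatzCM.embeddingAt ι Sp w₁ ϑ).im : ℝ) : ℂ) ≠ 0 := Complex.ofReal_ne_zero.mpr (hIm w₁)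
  have hI₂0 : (((KatzCM.embeddingAt ι Sp w₂ ϑ).im : ℝ) : ℂ) ≠ 0 := Complex.ofReal_ne_zero.mpr (hIm w₂)
  have hπ : (Real.pi : ℂ) ≠ 0 := Complex.ofReal_ne_zero.mpr Real.pi_ne_zero
  have hκ₂ : (if w₂ = w₁ then m + 1 else m + 1 - 1) = m := by rw [if_neg hw.symm, Nat.add_sub_cancel]
  have hLv := hLval χ (m + 1) hn hu hi hL
  have hrem : DeShalit1987.removedEulerFactorsAtZero (lam * χ.compRelNorm L) (S ∪ KatzCM.primesOver L p) = 1 :=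
    removedEulerFactorsAtZero_eq_one fun w hw' ↦
      not_isUnramifiedAt_mul (compRelNorm_isUnramifiedAt_of_forall hu w) (hramS w hw')
  have hG₁ : DeShalit1987.gammaFactorAtZero (1 + (m + 1)) = Complex.Gamma (((m + 1 : ℕ) : ℂ) + 1) := by
    unfold DeShalit1987.gammaFactorAtZero; push_cast; ring_nf
  have hG₂ : DeShalit1987.gammaFactorAtZero (1 + m) = Complex.Gamma ((m + 1 : ℕ) : ℂ) := by
    unfold DeShalit1987.gammaFactorAtZero; push_cast; ring_nf
  unfold KatzCM.interpolationValue
  rw [archFactor_two hw huniv, hrem, prod_eulerFactor_eq hramT hu, hLv, bdpInterpolationValue_of_dvd hpN, hap]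
  simp only [hκ₂, ite_true]
  rw [hG₁, hG₂, zero_mul, zero_mul, sub_zero, one_pow, div_pow]
  simp only [mul_pow, ← pow_mul, mul_one]
  field_simp
  ring

/-- The `p`-adic periods on the range: `∏_w Ω_p^{1+2κ_n(w)} = Ω_p^{4n}` for `κ_n = (n, n−1)` at the two places. [cite: Hsieh2014mu, Prop. 4.9 (§4.8)] -/
theorem prod_const_pow_eq {w₁ w₂ : InfinitePlace L} (hw : w₁ ≠ w₂) (huniv : ∀ w : InfinitePlace L, w = w₁ ∨ w = w₂)
    (Ωp : ℂ_[p]) {n : ℕ} (hn : 0 < n) :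
    ∏ w, (fun _ : InfinitePlace L ↦ Ωp) w ^ (1 + 2 * (fun w ↦ if w = w₁ then n else n - 1) w) = Ωp ^ (4 * n) := by
  rw [prod_univ_two hw huniv]
  show Ωp ^ (1 + 2 * (if w₁ = w₁ then n else n - 1)) * Ωp ^ (1 + 2 * (if w₂ = w₁ then n else n - 1)) = Ωp ^ (4 * n)
  rw [if_pos rfl, if_neg hw.symm, ← pow_add]
  congr 1
  omega


/-! ### §2 One choice of constants makes the ♭-frame take the Katz values on the range -/

/-- **THE KATZ LINE FRAME FROM THE ♭-FRAME.** `K` imaginary quadratic, `p` odd, `κ` anticyclotomic with `p ∤ h_K`; tied data at two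
places `w₁ ≠ w₂` with (L) `L(λ·χ∘N, 0) = c_L c_L′ⁿ RS(f ⊗ χ, 1)`, (P) `p ∣ N`, `a_p(f) = 0`, (R), `Im σ_w(ϑ) ≠ 0`; and a ♭-frame
`R1.IsBDPLFunctionInt p ι 𝔭 κ γ f Ω_K Ω_p Q` with `Ω_K, Ω_p ≠ 0`. Then for SOME `C_K ≠ 0`, `Ω_w ≠ 0`, `Ω′_{p,w} ≠ 0` the series `Q`
ITSELF takes, at every point `r(γ) − 1` of Hsieh's range, the Katz-normalised value
`ι⁻¹(interpolationValue ι Σ_p S T λ (χ∘N) 1 κ_n ϑ C_K Ω (L(λ·χ∘N,0))) · ∏_w Ω′_{p,w}^{1+2κ_n(w)}`. Constants: `Ω′_p ≡ Ω_p`,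
`C_K = (c_L Im σ₂(ϑ))⁻¹`, `Ω ≡ s` with `s^{4n₀} = (c_L′π⁴Ω_K⁴/(Im σ₁ Im σ₂))^{n₀}·δ(φ₁)` for the least range type `n₀` and a range
character `φ₁` of that type (vacuous choice if the range is empty); then `c₁(s)ⁿδ(χ) = 1` along the whole range by
`…RangeClassification.exists_defect_eq_pow`, and §1 turns the Katz value into Castella's. [cite: Hsieh2014mu, Prop. 4.9 (§4.8)]
[cite: Castella2018, Thm. 3.1 (arXiv:1704.06608 p. 9)] [cite: Brink2007, Cor. 1 (p. 2136)] -/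
theorem exists_constants_rangeFrame (hK : IsImaginaryQuadratic K) (hp2 : p ≠ 2) (κ : ZpExtension K p)
    (hκ : κ.IsAnticyclotomic) (hh : ¬ p ∣ NumberField.classNumber K) {γ : absoluteGaloisGroup K}
    {ι : PadicAlgCl p ≃+* ℂ} {Sp S T : Finset (HeightOneSpectrum (𝓞 L))}
    {lam : HeckeCharacter L} {ϑ : L} {N : ℕ} {f : CuspForm (CongruenceSubgroup.Gamma0 N) 2} {𝔭 : HeightOneSpectrum (𝓞 K)}
    {w₁ w₂ : InfinitePlace L} (hw : w₁ ≠ w₂) (huniv : ∀ w : InfinitePlace L, w = w₁ ∨ w = w₂)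
    {cL cL' : ℂ} (hcL : cL ≠ 0) (hcL' : cL' ≠ 0)
    (hLval : ∀ (χ : HeckeCharacter K) (n : ℕ), 0 < n → (∀ v : HeightOneSpectrum (𝓞 K), χ.IsUnramifiedAt v) →
      χ.HasInfinityType (fun _ ↦ (n : ℤ)) (fun _ ↦ -(n : ℤ)) →
      ∀ hL : LFunction.HasEntireContinuation (heckeLFunction (lam * χ.compRelNorm L)),
        hL.continuation 0 = cL * cL' ^ n * rankinSelbergValueHecke f χ 1)
    (hpN : p ∣ N) (hap : cuspCoeff f p = 0)
    (hramS : ∀ w ∈ S ∪ KatzCM.primesOver L p, ¬ lam.IsUnramifiedAt w)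
    (hramT : ∀ w ∈ Sp ∪ T, ¬ lam.IsUnramifiedAt w)
    (hIm : ∀ w, (KatzCM.embeddingAt ι Sp w ϑ).im ≠ 0) {ΩK : ℂ} (hΩK : ΩK ≠ 0) {Ωp : ℂ_[p]} (hΩp : Ωp ≠ 0)
    {Q : PowerSeries 𝓞_ℂ_[p]} (hQ : Summit.BirchSwinnertonDyer.Rank1Residual.X11b.R1.IsBDPLFunctionInt p ι 𝔭 κ γ f ΩK Ωp Q) :
    ∃ (CK : ℂ) (Ω : InfinitePlace L → ℂ) (ΩpK : InfinitePlace L → ℂ_[p]),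
      CK ≠ 0 ∧ (∀ w, Ω w ≠ 0) ∧ (∀ w, ΩpK w ≠ 0) ∧
      ∀ (χ : HeckeCharacter K) (n : ℕ), 0 < n → (∀ v : HeightOneSpectrum (𝓞 K), χ.IsUnramifiedAt v) →
        χ.HasInfinityType (fun _ ↦ (n : ℤ)) (fun _ ↦ -(n : ℤ)) →
        ∀ r : FramedGaloisRep K (PadicAlgCl p) 1, IsPAdicAvatarOf ι χ r → FactorsThroughZp κ r →
        ∀ hL : LFunction.HasEntireContinuation (heckeLFunction (lam * χ.compRelNorm L)),
          IntSeries.HasValueAt Q (avatarValueAt r γ - 1)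
            ((((ι.symm (KatzCM.interpolationValue ι Sp S T lam (χ.compRelNorm L) 1
                (fun w ↦ if w = w₁ then n else n - 1) ϑ CK Ω (hL.continuation 0))) : PadicAlgCl p) : ℂ_[p]) *
              ∏ w, ΩpK w ^ (1 + 2 * (fun w ↦ if w = w₁ then n else n - 1) w)) := by
  have hI₁0 : (((KatzCM.embeddingAt ι Sp w₁ ϑ).im : ℝ) : ℂ) ≠ 0 := Complex.ofReal_ne_zero.mpr (hIm w₁)
  have hI₂0 : (((KatzCM.embeddingAt ι Sp w₂ ϑ).im : ℝ) : ℂ) ≠ 0 := Complex.ofReal_ne_zero.mpr (hIm w₂)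
  have hπ : (Real.pi : ℂ) ≠ 0 := Complex.ofReal_ne_zero.mpr Real.pi_ne_zero
  by_cases hex : ∃ n : ℕ, 0 < n ∧ ∃ (χ : HeckeCharacter K) (r : FramedGaloisRep K (PadicAlgCl p) 1),
      (∀ v : HeightOneSpectrum (𝓞 K), χ.IsUnramifiedAt v) ∧
        χ.HasInfinityType (fun _ ↦ (n : ℤ)) (fun _ ↦ -(n : ℤ)) ∧ IsPAdicAvatarOf ι χ r ∧ FactorsThroughZp κ r
  · -- the least range type and a character realising it
    obtain ⟨hn₀, φ₁, r₁, hu₁, hi₁, hr₁, hf₁⟩ := Nat.find_spec hex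
    have hmin : ∀ s : ℕ, 0 < s → s < Nat.find hex →
        ¬ ∃ (χ : HeckeCharacter K) (r : FramedGaloisRep K (PadicAlgCl p) 1),
          (∀ v : HeightOneSpectrum (𝓞 K), χ.IsUnramifiedAt v) ∧
            χ.HasInfinityType (fun _ ↦ (s : ℤ)) (fun _ ↦ -(s : ℤ)) ∧ IsPAdicAvatarOf ι χ r ∧ FactorsThroughZp κ r :=
      fun s hs hlt hcon ↦ Nat.find_min hex hlt ⟨hs, hcon⟩
    -- the defect of `φ₁` and the period `s`
    set D₁ : ℂ := ∏ w ∈ Sp ∪ T, (φ₁.compRelNorm L).valueAtUniformizer w ^ (-(lam.conductorExponentAt w : ℤ))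
      with hD₁def
    have hD₁ : D₁ ≠ 0 := defect_ne_zero φ₁
    set A : ℂ := cL' * (Real.pi : ℂ) ^ 4 * ΩK ^ 4 /
      ((((KatzCM.embeddingAt ι Sp w₁ ϑ).im : ℝ) : ℂ) * (((KatzCM.embeddingAt ι Sp w₂ ϑ).im : ℝ) : ℂ)) with hAdef
    have hA : A ≠ 0 :=
      div_ne_zero (mul_ne_zero (mul_ne_zero hcL' (pow_ne_zero _ hπ)) (pow_ne_zero _ hΩK)) (mul_ne_zero hI₁0 hI₂0)
    have hZ : A ^ Nat.find hex * D₁ ≠ 0 := mul_ne_zero (pow_ne_zero _ hA) hD₁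
    obtain ⟨s, hs⟩ := IsAlgClosed.exists_pow_nat_eq (A ^ Nat.find hex * D₁) (show 0 < 4 * Nat.find hex by omega)
    have hs0 : s ≠ 0 := by
      rintro rfl
      rw [zero_pow (by omega)] at hs
      exact hZ hs.symm
    refine ⟨(cL * (((KatzCM.embeddingAt ι Sp w₂ ϑ).im : ℝ) : ℂ))⁻¹, fun _ ↦ s, fun _ ↦ Ωp,
      inv_ne_zero (mul_ne_zero hcL hI₂0), fun _ ↦ hs0, fun _ ↦ hΩp, ?_⟩
    intro χ n hn hu hi r hr hf hL
    obtain ⟨q, hnq, hδ⟩ := exists_defect_eq_pow hK hp2 κ hκ hh hn₀ hmin hu₁ hi₁ hr₁ hf₁ hu hi hr hf L (Sp ∪ T)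
      (fun w ↦ -(lam.conductorExponentAt w : ℤ))
    -- the constant in front of Castella's value is `1`
    have hc₁ : (cL' * (Real.pi : ℂ) ^ 4 * ΩK ^ 4 /
        ((((KatzCM.embeddingAt ι Sp w₁ ϑ).im : ℝ) : ℂ) * (((KatzCM.embeddingAt ι Sp w₂ ϑ).im : ℝ) : ℂ) * s ^ 4)) ^
          Nat.find hex * D₁ = 1 := by
      have h1 : cL' * (Real.pi : ℂ) ^ 4 * ΩK ^ 4 /
          ((((KatzCM.embeddingAt ι Sp w₁ ϑ).im : ℝ) : ℂ) * (((KatzCM.embeddingAt ι Sp w₂ ϑ).im : ℝ) : ℂ) * s ^ 4) =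
          A / s ^ 4 := by rw [hAdef, div_div]
      rw [h1, div_pow, ← pow_mul, hs, div_mul_eq_mul_div, mul_comm (A ^ Nat.find hex) D₁]
      exact div_self (mul_ne_zero hD₁ (pow_ne_zero _ hA))
    have hval : KatzCM.interpolationValue ι Sp S T lam (χ.compRelNorm L) 1 (fun w ↦ if w = w₁ then n else n - 1) ϑ
        ((cL * (((KatzCM.embeddingAt ι Sp w₂ ϑ).im : ℝ) : ℂ))⁻¹) (fun _ ↦ s) (hL.continuation 0) =
        bdpInterpolationValue p f 𝔭 χ n ΩK := by
      rw [interpolationValue_eq_of_range hw huniv hcL hcL' hLval hpN hap hramS hramT hIm hs0 hΩK hn hu hi hL, hδ, hnq,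
        mul_comm q, pow_mul, ← mul_pow, hc₁, one_pow, one_mul]
    rw [hval, prod_const_pow_eq hw huniv Ωp hn]
    exact hQ χ n hn hu hi r hr hf
  · refine ⟨1, fun _ ↦ 1, fun _ ↦ Ωp, one_ne_zero, fun _ ↦ one_ne_zero, fun _ ↦ hΩp, ?_⟩
    intro χ n hn hu hi r hr hf
    exact absurd ⟨n, hn, χ, r, hu, hi, hr, hf⟩ hex


/-! ### §3 The crux from the range form `V4R` of the input alone -/

/-- **The ♭-heart crux from `V4R` ALONE — no Katz–Hida–Tilouine measure, no Hsieh Theorem A, no Deuring hypothesis.** `V4R` is the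
registered research stub `stub_V4K` of line `hsieh_lambda` (skeletons v3–v5) with its ONE frame binder
`KatzCM.IsBaseChangeLine ι′ Σ_p S T κ γ λ ϑ C_K Ω Ω′_p G` replaced by the values of `G` on Hsieh's range
(`G(r(γ) − 1) = ι′⁻¹(interpolationValue ι′ Σ_p S T λ (χ∘N) 1 κ_n ϑ C_K Ω (L(λ·χ∘N, 0)))·∏_w Ω′_{p,w}^{1+2κ_n(w)}` for every
everywhere-unramified `χ` of type `(n, −n)`, `n ≥ 1`, with avatar `r` through `κ`) — the only values of `G` the line ever used. Proof:
the `[√d₀]` datum and `U = Stab(√d₀)` (p621092), the CM-datum adapter (Shapiro, `p`-part), the UNCONDITIONAL tied frame data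
(`…TiedFrameData.exists_tiedFrameData`: `L = K′(√d_CM)`, `Σ_p = {𝔓′}`, `S`, `T`, `λ`, `ϑ`, `w₁ ≠ w₂`, (T), (C), (L), (R)), the constants
of §2 making the crux's own `Q` an admissible `G`, and `V4R` at `G := Q`. [cite: Hsieh2014mu, Prop. 4.9 (§4.8)]
[cite: Castella2018, Thm. 3.1 (arXiv:1704.06608 p. 9)] [cite: PollackRubin2004, proof of Thm. 7.3] [cite: Brink2007, Cor. 1 (p. 2136)] -/
theorem eisensteinHeartFlatCMInertBadKPrime_of_V4R
    (hV4R : ∀ (W : WeierstrassCurve ℚ) [W.IsElliptic] [W.IsGloballyMinimal] (p : ℕ) [Fact p.Prime]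
        [NeZero (W.conductorNorm ℤ)] (K : Type) [Field K] [NumberField K],
        W.HasCM → 5 ≤ p → CMInert W p → ¬ Good W p →
        IsImaginaryQuadratic K → SatisfiesHeegnerHypothesis (W.conductorNorm ℤ) K →
        4 < (NumberField.discr K).natAbs → ¬ p ∣ NumberField.classNumber K →
        ∀ (κ : ZpExtension K p), κ.IsAnticyclotomic →
          ∀ (γ : Field.absoluteGaloisGroup K) [Fact (κ.IsTopGenerator γ)]
            (𝔭 : HeightOneSpectrum (𝓞 K)), ((p : ℕ) : 𝓞 K) ∈ 𝔭.asIdeal →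
            𝔭.asIdeal.ramificationIdx (𝓞 ℚ) = 1 → 𝔭.asIdeal.inertiaDeg (𝓞 ℚ) = 1 →
            ∀ (f : CuspForm (CongruenceSubgroup.Gamma0 (W.conductorNorm ℤ)) 2), IsNewformOf W f →
              ∀ (ι' : PadicAlgCl p ≃+* ℂ),
                (∀ (w : InfinitePlace K) (k : 𝓞 K), k ∈ 𝔭.asIdeal ↔ ‖ι'.symm (w.embedding (k : K))‖ < 1) →
                    ∀ (𝔭' : HeightOneSpectrum (𝓞 K)), ((p : ℕ) : 𝓞 K) ∈ 𝔭'.asIdeal → 𝔭' ≠ 𝔭 →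
                    Module.IsTorsion (IwasawaAlgebra p) (XAc (W.baseChange K) p κ 𝔭' ∅ γ) →
                    ∀ (L : Type) [Field L] [NumberField L] [Algebra K L] [IsGalois K L]
                      (Sp S T : Finset (HeightOneSpectrum (𝓞 L))) (lam : HeckeCharacter L) (ϑ : L) (CK : ℂ)
                      (Ω : InfinitePlace L → ℂ) (ΩpK : InfinitePlace L → ℂ_[p]) (G : PowerSeries 𝓞_ℂ_[p])
                      (w₁ w₂ : InfinitePlace L) (cL cL' : ℂ),
                      w₁ ≠ w₂ → (∀ w : InfinitePlace L, w = w₁ ∨ w = w₂) →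
                      (∀ (χ : HeckeCharacter K) (n : ℕ), 0 < n → (∀ v : HeightOneSpectrum (𝓞 K), χ.IsUnramifiedAt v) →
                        χ.HasInfinityType (fun _ ↦ (n : ℤ)) (fun _ ↦ -(n : ℤ)) →
                        KatzCM.HasKatzType ι' Sp (lam * χ.compRelNorm L) 1 (fun w ↦ if w = w₁ then n else n - 1)) →
                      (∀ (χ : HeckeCharacter K) (n : ℕ), 0 < n → (∀ v : HeightOneSpectrum (𝓞 K), χ.IsUnramifiedAt v) →
                        χ.HasInfinityType (fun _ ↦ (n : ℤ)) (fun _ ↦ -(n : ℤ)) →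
                        LFunction.HasEntireContinuation (heckeLFunction (lam * χ.compRelNorm L))) →
                      cL ≠ 0 → cL' ≠ 0 →
                      (∀ (χ : HeckeCharacter K) (n : ℕ), 0 < n → (∀ v : HeightOneSpectrum (𝓞 K), χ.IsUnramifiedAt v) →
                        χ.HasInfinityType (fun _ ↦ (n : ℤ)) (fun _ ↦ -(n : ℤ)) →
                        ∀ hL : LFunction.HasEntireContinuation (heckeLFunction (lam * χ.compRelNorm L)),
                          hL.continuation 0 = cL * cL' ^ n * rankinSelbergValueHecke f χ 1) →
                      (∀ w ∈ S ∪ KatzCM.primesOver L p, ¬ lam.IsUnramifiedAt w) →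
                      (∀ w ∈ Sp ∪ T, ¬ lam.IsUnramifiedAt w) →
                      CK ≠ 0 → (∀ w, Ω w ≠ 0) → (∀ w, (KatzCM.embeddingAt ι' Sp w ϑ).im ≠ 0) → (∀ w, ΩpK w ≠ 0) →
                      (∀ (χ : HeckeCharacter K) (n : ℕ), 0 < n → (∀ v : HeightOneSpectrum (𝓞 K), χ.IsUnramifiedAt v) →
                        χ.HasInfinityType (fun _ ↦ (n : ℤ)) (fun _ ↦ -(n : ℤ)) →
                        ∀ r : FramedGaloisRep K (PadicAlgCl p) 1, IsPAdicAvatarOf ι' χ r → FactorsThroughZp κ r →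
                        ∀ hL : LFunction.HasEntireContinuation (heckeLFunction (lam * χ.compRelNorm L)),
                          IntSeries.HasValueAt G (avatarValueAt r γ - 1)
                            ((((ι'.symm (KatzCM.interpolationValue ι' Sp S T lam (χ.compRelNorm L) 1
                                (fun w ↦ if w = w₁ then n else n - 1) ϑ CK Ω (hL.continuation 0))) : PadicAlgCl p) : ℂ_[p]) *
                              ∏ w, ΩpK w ^ (1 + 2 * (fun w ↦ if w = w₁ then n else n - 1) w))) →
                    ∀ (d₀ : ℤ) (r : AlgebraicClosure K) (ψ : (W.baseChange K).geomPoints →+ (W.baseChange K).geomPoints),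
                      r * r = algebraMap K (AlgebraicClosure K) (d₀ : K) →
                      r ∉ Set.range (algebraMap K (AlgebraicClosure K)) →
                      (∀ y : ZMod p, y * y ≠ PadicInt.toZMod ((d₀ : ℤ) : ℤ_[p])) →
                      (∀ σ : absoluteGaloisGroup K, σ • r = r → ∀ P : (W.baseChange K).geomPoints, σ • ψ P = ψ (σ • P)) →
                      (∀ σ : absoluteGaloisGroup K, σ • r = -r → ∀ P : (W.baseChange K).geomPoints, σ • ψ P = -ψ (σ • P)) →
                      (∀ P, ψ (ψ P) = d₀ • P) →
                    ∀ (U : Subgroup (absoluteGaloisGroup K)) [U.Normal], (∀ σ, σ ∈ U ↔ σ • r = r) →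
                    ∀ (φ : (W.baseChange K).geomPrimaryTorsion p →+ (W.baseChange K).geomPrimaryTorsion p)
                      (_ : ∀ m, ((φ m : (W.baseChange K).geomPrimaryTorsion p) : (W.baseChange K).geomPoints) = ψ m)
                      (hφH' : ∀ (x : (κ.kerSubgroup ⊓ U : Subgroup (absoluteGaloisGroup K)))
                        (m : (W.baseChange K).geomPrimaryTorsion p), φ (x • m) = x • φ m)
                      (hφU : ∀ σ ∈ U, ∀ m : (W.baseChange K).geomPrimaryTorsion p, φ (σ • m) = σ • φ m)
                      (hφU' : ∀ σ, σ ∉ U → ∀ m : (W.baseChange K).geomPrimaryTorsion p, φ (σ • m) = -(σ • φ m))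
                      (hφ2 : ∀ m, φ (φ m) = d₀ • m)
                      (γ' : absoluteGaloisGroup K) (_ : κ.IsTopGenerator γ') (_ : γ' ∈ U)
                      (f₁ : AddMonoid.End (selmerOver (κ.kerSubgroup ⊓ U) ((W.baseChange K).geomPrimaryTorsion p) p 𝔭' ∅))
                      (_hf : ∀ s, ((f₁ s : selmerOver (κ.kerSubgroup ⊓ U) ((W.baseChange K).geomPrimaryTorsion p) p 𝔭' ∅) :
                        subgroupH1 (κ.kerSubgroup ⊓ U) ((W.baseChange K).geomPrimaryTorsion p)) =
                          conjH1 (κ.kerSubgroup ⊓ U) ((W.baseChange K).geomPrimaryTorsion p) γ' s)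
                      (h : IsLocNil p (f₁ - 1))
                      (δ : LocNilDual (selmerOver (κ.kerSubgroup ⊓ U) ((W.baseChange K).geomPrimaryTorsion p) p 𝔭' ∅) f₁ h
                        →ₗ[IwasawaAlgebra p]
                        LocNilDual (selmerOver (κ.kerSubgroup ⊓ U) ((W.baseChange K).geomPrimaryTorsion p) p 𝔭' ∅) f₁ h)
                      (hδ : ∀ (x : LocNilDual (selmerOver (κ.kerSubgroup ⊓ U) ((W.baseChange K).geomPrimaryTorsion p) p 𝔭' ∅) f₁ h)
                        (s t : selmerOver (κ.kerSubgroup ⊓ U) ((W.baseChange K).geomPrimaryTorsion p) p 𝔭' ∅),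
                        (t : subgroupH1 (κ.kerSubgroup ⊓ U) ((W.baseChange K).geomPrimaryTorsion p)) =
                          resH1Hom (ContinuousMonoidHom.id _) φ hφH'
                            (s : subgroupH1 (κ.kerSubgroup ⊓ U) ((W.baseChange K).geomPrimaryTorsion p)) → δ x s = x t)
                      (b : Module.Basis (Fin 2) ℤ_[p]
                        (AdjoinRoot (Polynomial.X ^ 2 - Polynomial.C ((d₀ : ℤ) : ℤ_[p]) : Polynomial ℤ_[p]))) (hb0 : b 0 = 1)
                      (hb1 : b 1 * b 1 = algebraMap ℤ_[p]
                        (AdjoinRoot (Polynomial.X ^ 2 - Polynomial.C ((d₀ : ℤ) : ℤ_[p]) : Polynomial ℤ_[p])) ((d₀ : ℤ) : ℤ_[p]))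
                      (ι : AdjoinRoot (Polynomial.X ^ 2 - Polynomial.C ((d₀ : ℤ) : ℤ_[p]) : Polynomial ℤ_[p]) →+* 𝓞_ℂ_[p])
                      (_ : ι.comp (algebraMap ℤ_[p] _) = R1.toCpInt p),
                      ∃ m : ℕ, ∀ x ∈ (charIdeal (PowerSeries
                          (AdjoinRoot (Polynomial.X ^ 2 - Polynomial.C ((d₀ : ℤ) : ℤ_[p]) : Polynomial ℤ_[p])))
                          (WithQuadratic (LocNilDual (selmerOver (κ.kerSubgroup ⊓ U) ((W.baseChange K).geomPrimaryTorsion p)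
                            p 𝔭' ∅) f₁ h) b hb0 hb1 δ
                            (delta_sq (W.baseChange K) κ 𝔭' ∅ U φ hφH' hφU hφU' d₀ hφ2 f₁ h δ hδ))).map (PowerSeries.map ι),
                        (PowerSeries.C ((p : ℕ) : 𝓞_ℂ_[p]) : PowerSeries 𝓞_ℂ_[p]) ^ m * x ∈ Ideal.span {G}) :
    Summit.BirchSwinnertonDyer.BirchSwinnertonDyer.Theses.BiquadraticEisensteinDescent.EisensteinHeartFlatCMInertBadKPrime := by
  intro W _ _ p _ _ K _ _ hCM _hr hp5 hin hbad hK hHN hd4 hh _hLt κ hκ γ _ 𝔭 h𝔭 he hf1 f hf ι' hι ΩK Ωp Q hΩK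
    hQ 𝔭' h𝔭' hne htors
  have hp : p.Prime := Fact.out
  have hp2 : p ≠ 2 := by omega
  have hpN : p ∣ W.conductorNorm ℤ := (W.dvd_conductorNorm_iff_not_hasGoodReductionAtPrime p).mpr hbad
  -- the CM endomorphism `[√d₀]` over `K′` and the index-two subgroup `U = Γ_L`
  obtain ⟨d₀, r, ψ, hr, hrK, hd, hψU, hψU', hψ2⟩ := Summit.BirchSwinnertonDyer.BirchSwinnertonDyer.Theorems.BiquadraticEisensteinDescentEisensteinHeartFlatCMInertBadKPrimeSqrtEndomorphismAllJ.stub_sqrtEndomorphism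
      W p K hCM hp5 hin hbad hK hHN 𝔭 𝔭' h𝔭 h𝔭' hne
  let U : Subgroup (absoluteGaloisGroup K) := MulAction.stabilizer (absoluteGaloisGroup K) r
  have hUr : ∀ σ, σ ∈ U ↔ σ • r = r := fun σ ↦ MulAction.mem_stabilizer_iff
  haveI : U.Normal :=
    Summit.BirchSwinnertonDyer.BirchSwinnertonDyer.Theorems.BiquadraticEisensteinDescentEisensteinHeartFlatCMInertBadKPrimeCMDatumAdapter.normal_of_forall_mem_iff
      r (d₀ : K) hr hrK U hUr
  haveI : (W.baseChange K).IsElliptic := inferInstanceAs (W.map (algebraMap ℚ K)).IsElliptic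
  haveI : Module.Finite (IwasawaAlgebra p) (XAc (W.baseChange K) p κ 𝔭' ∅ γ) := XAc.module_finite_empty κ 𝔭' γ
  have hΩp : ((Ωp : unrIntegers p) : ℂ_[p]) ≠ 0 := by
    rw [Ne, ZeroMemClass.coe_eq_zero]
    exact Ωp.ne_zero
  have hap : cuspCoeff f p = 0 :=
    Summit.BirchSwinnertonDyer.BirchSwinnertonDyer.Theorems.BiquadraticEisensteinDescentEisensteinHeartFlatCMInertBadKPrimeCuspCoeffVanishing.cuspCoeff_eq_zero_of_hasCM_of_not_good
      hCM hbad hf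
  refine Summit.BirchSwinnertonDyer.BirchSwinnertonDyer.Theorems.BiquadraticEisensteinDescentEisensteinHeartFlatCMInertBadKPrimeCMDatumAdapter.heartShape_xac_of_sqrt_endomorphism
    (W.baseChange K) κ 𝔭' ∅ U hp2 γ ψ d₀ r hr hrK hUr hψU hψU' hψ2 hd htors ?_
  intro φ hφψ hφH' hφU hφU' hφ2 γ' hγ' hγ'U f₁ hf₁ h δ hδ b hb0 hb1 ιO hιO
  -- the tied frame data (unconditional) and the constants making `Q` an admissible Katz line series on the range
  obtain ⟨L, _, _, _, _, Sp, S, T, lam, ϑ, w₁, w₂, cL, cL', hw, huniv, hT, hcont, hcL, hcL', hLval, hramS, hramT, hIm⟩ :=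
    Summit.BirchSwinnertonDyer.BirchSwinnertonDyer.Theorems.BiquadraticEisensteinDescentEisensteinHeartFlatCMInertBadKPrimeTiedFrameData.exists_tiedFrameData
      W p K hCM hp5 hin hbad hK hHN hd4 hh κ hκ γ 𝔭 h𝔭 he hf1 f hf ι' hι 𝔭' h𝔭' hne
  obtain ⟨CK, Ω, ΩpK, hCK, hΩ, hΩpK, hGQ⟩ :=
    exists_constants_rangeFrame hK hp2 κ hκ hh hw huniv hcL hcL' hLval hpN hap hramS hramT hIm hΩK hΩp hQ
  -- THE INPUT at `G := Q`
  exact hV4R W p K hCM hp5 hin hbad hK hHN hd4 hh κ hκ γ 𝔭 h𝔭 he hf1 f hf ι' hι 𝔭' h𝔭' hne htors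
    L Sp S T lam ϑ CK Ω ΩpK Q w₁ w₂ cL cL' hw huniv hT hcont hcL hcL' hLval hramS hramT hCK hΩ hIm hΩpK hGQ
    d₀ r ψ hr hrK hd hψU hψU' hψ2 U hUr φ hφψ hφH' hφU hφU' hφ2 γ' hγ' hγ'U f₁ hf₁ h δ hδ b hb0 hb1 ιO hιO

end Summit.BirchSwinnertonDyer.BirchSwinnertonDyer.Theorems.BiquadraticEisensteinDescentEisensteinHeartFlatCMInertBadKPrimeKatzLineFromFlat

end
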